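import Mathlib
import Literature.AlgebraicGeometry.Resolution.LocalBlowup
import Literature.AlgebraicGeometry.Resolution.QuadraticTransforms
import Literature.AlgebraicGeometry.Resolution.QuadraticTransformsRegular
import Literature.AlgebraicGeometry.Resolution.QuadraticTransformsStructure
import Literature.AlgebraicGeometry.Resolution.BlowupRingExceptionalFibre
import Literature.AlgebraicGeometry.Resolution.BlowupRingChartCoordinates
import Literature.AlgebraicGeometry.Resolution.RegularSystemOfParameters
import Summits.ResolutionOfSingularities.ResolutionOfSingularities.Theorems.RadicialJungCleanModelsLens5PRankTwoCurrency
import Summits.ResolutionOfSingularities.ResolutionOfSingularities.Theorems.RadicialJungCleanModelsCleanLU3ArcPackage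
import Summits.ResolutionOfSingularities.ResolutionOfSingularities.Theorems.RadicialJungCleanModelsConeExitPrelims
import Summits.ResolutionOfSingularities.ResolutionOfSingularities.Theorems.RadicialJungCleanModelsConeExitMorsePrelims
import HarnessLib

/-!
# Route `RadicialJung`, crux `CleanModels` (stmt-15917), line `Sketch`: the MORSE EXIT — part 2/2: a nondegenerate quadratic END stage is cleaned by ONE quadratic transform, for EVERY valuation

Line lead `res-B-lead-1` g10, `--supports stmt-ResolutionOfSingularities-15917`.  Sequel to ✓ `…ConeExitPrelims` / ✓ `…ConeExit`
(`ConeExit.cleanLUConcl_or_coneVertex`: after one quadratic transform the line is loosely clean UNLESS the new centre is a singular point of the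
projectivised tangent cone of `h`).  Here the case `e = 2` (the only one at `p = 3`) is made intrinsic to the stage: if `h ≡ Q(t) (mod 𝔪³)` for a
quadratic form `Q(T) = Σ a_ij T_i T_j` in a regular system of parameters `t` whose POLAR LINEAR FORMS `D_k = Σ_j (a_kj + a_jk) t_j` span `𝔪/𝔪²`
(nondegenerate Hessian; at a point with perfect residue field: a non-degenerate critical point of the purely inseparable function — MORSE), then the
projective quadric `V(Q̄)` has no singular point, so NO valuation can return: `h = x² G` with `G ∉ 𝔪₁² + (x)` in every quadratic transform, and the line is
loosely clean there (form (1), exponent `2`, `p ≠ 2`).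

(Polynomial prelims — `quadChart`, `polarChart`, the Jacobian argument `mem_of_mul_quadChart_mem_sq`, `isQuadraticTransformAlong_chart` — in part 1,
`RadicialJungCleanModelsConeExitMorsePrelims.lean`.)
* `not_coneVertex_of_nondegenerate` — THE MORSE EXIT at ring level: `G ∉ 𝔪_{R₁}² + (x)`.
* `cleanLUConcl_of_nondegenerate` — model level: `CleanLUConcl` for every `O` through such a stage (`p ≠ 2`).

Honest framing: OURS · counted 0 · nothing here proves resolution in characteristic `p`; no registered stub is closed.  With ✓ `…ConeExit` this says: at
`p = 3` the research residual `stub_cleanLU3DefectNonDiscrete` only ever meets END stages of the printed phase at DEGENERATE (corank `≥ 1`) quadratic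
critical points, and must then move to the singular locus of the cone.
-/

noncomputable section

set_option linter.dupNamespace false

open IsLocalRing MvPolynomial
open Literature.AlgebraicGeometry.Resolution
open Summit.ResolutionOfSingularities.ResolutionOfSingularities.Theorems.RadicialJung.CleanModels.Lens5.PRankTwoCurrency

namespace Summit.ResolutionOfSingularities.ResolutionOfSingularities.Theorems.RadicialJung.CleanModels.ConeExit

universe u

/-! ## §3 The Morse exit at ring level -/

section Ring

variable {K : Type u} [Field K]

/-- **THE MORSE EXIT (ring level): no return through a nondegenerate quadratic tangent cone.**  Let `R ⊆ K` be a regular local ring dominated by the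
valuation ring `O`, `t` a regular system of parameters, `a_ij ∈ R` and `h ∈ R` with `h ≡ Σ a_ij t_i t_j (mod 𝔪³)`, and assume the polar linear forms
`D_k = Σ_j (a_kj + a_jk) t_j` span `𝔪` modulo `𝔪²` (NONDEGENERACY).  Let `t_{i₀}` have minimal value in `𝔪` and let `R₁ = (R[𝔪/t_{i₀}])_{𝔪_O ∩ …}` be the
quadratic transform along `O`.  Then for the strict factor `G ∈ R₁`, `h = t_{i₀}² G`, one has `G ∉ 𝔪_{R₁}² + (t_{i₀})`: the centre of `O` on the blown-up
ring is NOT a singular point of the (smooth) projective quadric `V(Q̄)`.  Proof: in `R[𝔪/x]/(x) ≅ κ[T̃_j : j ≠ i₀]` (Stacks 0BIQ, ✓ `blowupRing_chartQuotient_X`)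
the class of `G` is the dehomogenised form `q̄`; nondegeneracy dehomogenises to `1 ∈ (L_k)_k`, hence (`∂_k q̄ = L_k`, Euler) `1 ∈ (q̄, ∂q̄)` at any prime where
`q̄` is symbolically a square — impossible (`mem_of_mul_quadChart_mem_sq`); and `G ∈ 𝔪₁² + (x)` would put `q̄` in the symbolic square of the centre's
prime (`R₁/(x)` is the localisation of `R[𝔪/x]/(x)` at it). [folklore] -/
theorem not_coneVertex_of_nondegenerate {O : ValuationSubring K} {R : Subring K} [IsRegularLocalRing R]
    (hdom : SubringDominates R O.toSubring)
    {d : ℕ} (hd : (maximalIdeal R).spanFinrank = d) (t : Fin d → R) (ht : Ideal.span (Set.range t) = maximalIdeal R)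
    (a : Fin d → Fin d → R) (h : R) (hQ : h - ∑ i, ∑ j, a i j * t i * t j ∈ maximalIdeal R ^ 3)
    (hJ : ∀ i, t i ∈ Ideal.span (Set.range fun k => ∑ j, (a k j + a j k) * t j) ⊔ maximalIdeal R ^ 2)
    (i₀ : Fin d) (hmin : ∀ y ∈ maximalIdeal R, O.valuation (y : K) ≤ O.valuation (t i₀ : K))
    [IsLocalRing (locAtCentre (blowupRing R ((t i₀ : R) : K)) O)]
    (G : locAtCentre (blowupRing R ((t i₀ : R) : K)) O) (hG : (h : K) = ((t i₀ : R) : K) ^ 2 * (G : K)) :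
    G ∉ maximalIdeal (locAtCentre (blowupRing R ((t i₀ : R) : K)) O) ^ 2 ⊔
      Ideal.span {(⟨((t i₀ : R) : K), le_locAtCentre _ O (le_blowupRing R _ (t i₀).2)⟩ :
        locAtCentre (blowupRing R ((t i₀ : R) : K)) O)} := by
  classical
  have hRO : R ≤ O.toSubring := hdom.1
  have hx : t i₀ ∈ maximalIdeal R := ht ▸ Ideal.subset_span ⟨i₀, rfl⟩
  have hx0 : t i₀ ≠ 0 := rsop_ne_zero hd t ht i₀
  have hx0K : ((t i₀ : R) : K) ≠ 0 := fun h0 => hx0 (Subtype.ext h0)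
  have htm : ∀ j, t j ∈ maximalIdeal R := fun j => ht ▸ Ideal.subset_span ⟨j, rfl⟩
  -- the transform in the `t i₀`-chart: `R₁ = locAtCentre B O`, `B = R[𝔪/t i₀]`
  have hq' := isQuadraticTransformAlong_chart hRO (t i₀) hx hx0 hmin
  have hBR₁ : blowupRing R ((t i₀ : R) : K) ≤ locAtCentre (blowupRing R ((t i₀ : R) : K)) O := le_locAtCentre _ O
  have hBO : blowupRing R ((t i₀ : R) : K) ≤ O.toSubring := hBR₁.trans hq'.target_le
  have hRB : R ≤ blowupRing R ((t i₀ : R) : K) := le_blowupRing R _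
  have hxR₁ : ((t i₀ : R) : K) ∈ locAtCentre (blowupRing R ((t i₀ : R) : K)) O := hBR₁ (hRB (t i₀).2)
  -- elements of `B`
  let xB : blowupRing R ((t i₀ : R) : K) := ⟨((t i₀ : R) : K), hRB (t i₀).2⟩
  have htB : ∀ j, ((t j : R) : K) / ((t i₀ : R) : K) ∈ blowupRing R ((t i₀ : R) : K) :=
    fun j => div_mem_blowupRing _ (htm j)
  let tB : Fin d → blowupRing R ((t i₀ : R) : K) := fun j => ⟨((t j : R) : K) / ((t i₀ : R) : K), htB j⟩
  let aB : Fin d → Fin d → blowupRing R ((t i₀ : R) : K) := fun i j => ⟨((a i j : R) : K), hRB (a i j).2⟩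
  have htB0 : tB i₀ = 1 := Subtype.ext (div_self hx0K)
  -- `h = x² G_B` with `G_B = Σ a_ij t̃_i t̃_j + x r̃`
  obtain ⟨r, hr⟩ := exists_eq_pow_mul_of_mem_pow (R₁ := blowupRing R ((t i₀ : R) : K)) hx0K le_rfl hQ
  let GB : blowupRing R ((t i₀ : R) : K) := ∑ i, ∑ j, aB i j * tB i * tB j + xB * r
  have hGBK : (GB : K) = ∑ i, ∑ j, ((a i j : R) : K) * (((t i : R) : K) / ((t i₀ : R) : K)) * (((t j : R) : K) / ((t i₀ : R) : K)) +
      ((t i₀ : R) : K) * (r : K) := by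
    simp [GB, aB, tB, xB]
  have hhGB : (h : K) = ((t i₀ : R) : K) ^ 2 * (GB : K) := by
    have hrK : ((h - ∑ i, ∑ j, a i j * t i * t j : R) : K) =
        (h : K) - ∑ i, ∑ j, ((a i j : R) : K) * ((t i : R) : K) * ((t j : R) : K) := by
      simp
    rw [hrK] at hr
    have key : ∀ i j : Fin d, ((t i₀ : R) : K) ^ 2 * (((a i j : R) : K) * (((t i : R) : K) / ((t i₀ : R) : K)) *
        (((t j : R) : K) / ((t i₀ : R) : K))) = ((a i j : R) : K) * ((t i : R) : K) * ((t j : R) : K) := by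
      intro i j; field_simp
    rw [hGBK, mul_add, Finset.mul_sum]
    simp_rw [Finset.mul_sum, key]
    have : ((t i₀ : R) : K) ^ 2 * (((t i₀ : R) : K) * (r : K)) = ((t i₀ : R) : K) ^ 3 * (r : K) := by ring
    rw [this, ← hr]
    ring
  have hGGB : G = ⟨(GB : K), hBR₁ GB.2⟩ := by
    apply Subtype.ext
    exact mul_left_cancel₀ (pow_ne_zero 2 hx0K) (hG.symm.trans hhGB)
  -- the polars in `B`
  let DB : Fin d → blowupRing R ((t i₀ : R) : K) := fun k => ∑ j, (aB k j + aB j k) * tB j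
  -- nondegeneracy at `i₀`, divided by `x`: `1 = Σ b_k D̃_k + x m̃`
  obtain ⟨y, hy, m, hm, hym⟩ := Submodule.mem_sup.mp (hJ i₀)
  obtain ⟨b, hb⟩ := Ideal.mem_span_range_iff_exists_fun.mp hy
  obtain ⟨m', hm'⟩ := exists_eq_pow_mul_of_mem_pow (R₁ := blowupRing R ((t i₀ : R) : K)) hx0K le_rfl hm
  let bB : Fin d → blowupRing R ((t i₀ : R) : K) := fun k => ⟨((b k : R) : K), hRB (b k).2⟩
  have hone : (1 : blowupRing R ((t i₀ : R) : K)) = ∑ k, bB k * DB k + xB * m' := by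
    apply Subtype.ext
    have hymK : ((y : R) : K) + ((m : R) : K) = ((t i₀ : R) : K) := by
      rw [← Subring.coe_add, hym]
    have hyK : ((y : R) : K) = ∑ k, ((b k : R) : K) * ∑ j, (((a k j : R) : K) + ((a j k : R) : K)) * ((t j : R) : K) := by
      rw [← hb]; simp
    have hmK : ((m : R) : K) = ((t i₀ : R) : K) ^ 2 * (m' : K) := hm'
    have hxK' : ((t i₀ : R) : K) = ((y : R) : K) + ((t i₀ : R) : K) ^ 2 * (m' : K) := by
      linear_combination (-1 : K) * hymK + hmK
    have hlhs : (((∑ k, bB k * DB k + xB * m' : blowupRing R ((t i₀ : R) : K))) : K) =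
        ∑ k, ((b k : R) : K) * ∑ j, (((a k j : R) : K) + ((a j k : R) : K)) * (((t j : R) : K) / ((t i₀ : R) : K)) +
          ((t i₀ : R) : K) * (m' : K) := by
      simp [bB, DB, aB, tB, xB]
    rw [hlhs, OneMemClass.coe_one]
    have hdiv : ∀ k, ((b k : R) : K) * ∑ j, (((a k j : R) : K) + ((a j k : R) : K)) * (((t j : R) : K) / ((t i₀ : R) : K)) =
        (((b k : R) : K) * ∑ j, (((a k j : R) : K) + ((a j k : R) : K)) * ((t j : R) : K)) / ((t i₀ : R) : K) := by
      intro k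
      rw [mul_div_assoc, Finset.sum_div]
      congr 1
      exact Finset.sum_congr rfl fun j _ => by rw [mul_div_assoc]
    simp_rw [hdiv]
    rw [← Finset.sum_div, ← hyK]
    field_simp
    linear_combination hxK'
  -- the exceptional fibre `B/(x) ≅ κ[T̃]`
  obtain ⟨ψ, hψbij, hψC, hψX⟩ := blowupRing_chartQuotient_X R hd t ht i₀ hx0
  let I : Ideal (blowupRing R ((t i₀ : R) : K)) := Ideal.span {xB}
  let mk : blowupRing R ((t i₀ : R) : K) →+* blowupRing R ((t i₀ : R) : K) ⧸ I := Ideal.Quotient.mk I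
  have hmkx : mk xB = 0 := Ideal.Quotient.eq_zero_iff_mem.mpr (Ideal.mem_span_singleton_self xB)
  -- the chart variables `T̃` (`T̃_{i₀} = 1`), the coefficients `C ā_ij`, the dehomogenised form `q̄` and its polars `L̄_k` in `κ[T̃_j : j ≠ i₀]`
  let Tt : Fin d → MvPolynomial {j : Fin d // j ≠ i₀} (ResidueField R) := fun i => if hi : i = i₀ then 1 else X ⟨i, hi⟩
  let aC : Fin d → Fin d → MvPolynomial {j : Fin d // j ≠ i₀} (ResidueField R) := fun i j => C (residue R (a i j))
  have hTt0 : Tt i₀ = 1 := by simp [Tt]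
  have hTt : ∀ {i : Fin d} (hi : i ≠ i₀), Tt i = X ⟨i, hi⟩ := fun hi => by simp [Tt, hi]
  have hDT : ∀ (k : Fin d) (hk : k ≠ i₀) (i : Fin d), pderiv ⟨k, hk⟩ (Tt i) = if i = k then 1 else 0 := by
    intro k hk i
    by_cases hi : i = i₀
    · subst hi
      rw [hTt0, if_neg (fun h => hk h.symm)]
      simp
    · rw [hTt hi]
      by_cases hik : i = k
      · subst hik
        rw [pderiv_X_self, if_pos rfl]
      · have hne : (⟨i, hi⟩ : {j : Fin d // j ≠ i₀}) ≠ ⟨k, hk⟩ := fun h => hik (congrArg Subtype.val h)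
        rw [pderiv_X_of_ne hne, if_neg hik]
  have hDa : ∀ (k : Fin d) (hk : k ≠ i₀) (i j : Fin d), pderiv ⟨k, hk⟩ (aC i j) = 0 := fun k hk i j => pderiv_C
  obtain ⟨qbar, hqdef⟩ : ∃ q : MvPolynomial {j : Fin d // j ≠ i₀} (ResidueField R), q = ∑ i, ∑ j, aC i j * Tt i * Tt j := ⟨_, rfl⟩
  have hψT : ∀ i, ψ (Tt i) = mk (tB i) := by
    intro i
    by_cases hi : i = i₀
    · subst hi
      rw [hTt0, map_one, htB0, map_one]
    · rw [hTt hi]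
      exact hψX ⟨i, hi⟩ (htB i)
  have hψa : ∀ i j, ψ (aC i j) = mk (aB i j) := fun i j => hψC (a i j)
  have hψG : ψ qbar = mk GB := by
    simp only [hqdef, map_sum, map_mul, hψa, hψT, GB, map_add, hmkx, zero_mul, add_zero]
  have hψD : ∀ k, ψ (∑ j, (aC k j + aC j k) * Tt j) = mk (DB k) := by
    intro k
    simp only [map_sum, map_mul, map_add, hψa, hψT, DB]
  let e : MvPolynomial {j : Fin d // j ≠ i₀} (ResidueField R) ≃+* blowupRing R ((t i₀ : R) : K) ⧸ I :=
    RingEquiv.ofBijective ψ hψbij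
  have he : ∀ z, e z = ψ z := fun z => rfl
  -- `1 = Σ β_k L̄_k` in `κ[T̃]`
  let β : Fin d → MvPolynomial {j : Fin d // j ≠ i₀} (ResidueField R) := fun k => e.symm (mk (bB k))
  have hβ : ∑ k, β k * ∑ j, (aC k j + aC j k) * Tt j = 1 := by
    apply e.injective
    rw [map_one, map_sum]
    have h1 : mk (1 : blowupRing R ((t i₀ : R) : K)) = 1 := map_one mk
    rw [← h1, hone, map_add, map_mul mk xB, hmkx, zero_mul, add_zero, map_sum]
    refine Finset.sum_congr rfl fun k _ => ?_
    rw [map_mul, map_mul, he, he, hψD]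
    congr 1
    rw [← he]
    exact e.apply_symm_apply _
  -- suppose the centre IS a singular point of the cone
  intro hGt
  -- `R₁` is the localisation of `B` at the centre `𝔫 ∋ x`
  let 𝔫 : Ideal (blowupRing R ((t i₀ : R) : K)) := subringCentre _ O hBO
  haveI := isLocalization_locAtCentre (K := K) (O := O) hBO
  have hvx : O.valuation ((t i₀ : R) : K) < 1 := ((subringDominates_valuationSubring_iff hRO).mp hdom (t i₀)).mp hx
  have hx𝔫 : xB ∈ 𝔫 := (mem_subringCentre_iff hBO xB).mpr hvx
  -- transport `hGt` to `B`: `s · G_B ∈ 𝔫² + (x)` for some `s ∉ 𝔫`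
  have hGt' : ∃ s : blowupRing R ((t i₀ : R) : K), s ∉ 𝔫 ∧ s * GB ∈ 𝔫 ^ 2 ⊔ I := by
    have halg : algebraMap _ (locAtCentre (blowupRing R ((t i₀ : R) : K)) O) xB = ⟨((t i₀ : R) : K), hxR₁⟩ :=
      Subtype.ext rfl
    have hmap : maximalIdeal (locAtCentre (blowupRing R ((t i₀ : R) : K)) O) ^ 2 ⊔
        Ideal.span {(⟨((t i₀ : R) : K), hxR₁⟩ : locAtCentre (blowupRing R ((t i₀ : R) : K)) O)} =
        (𝔫 ^ 2 ⊔ I).map (algebraMap _ (locAtCentre (blowupRing R ((t i₀ : R) : K)) O)) := by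
      rw [Ideal.map_sup, Ideal.map_pow, IsLocalization.AtPrime.map_eq_maximalIdeal 𝔫 (locAtCentre (blowupRing R ((t i₀ : R) : K)) O),
        Ideal.map_span, Set.image_singleton, halg]
    rw [hmap, IsLocalization.mem_map_algebraMap_iff 𝔫.primeCompl] at hGt
    obtain ⟨⟨⟨y', hy'⟩, ⟨s, hs⟩⟩, hys⟩ := hGt
    refine ⟨s, hs, ?_⟩
    have : s * GB = y' := by
      apply Subtype.ext
      have h1 := congrArg (fun z : locAtCentre (blowupRing R ((t i₀ : R) : K)) O => (z : K)) hys
      simp only [Subring.coe_mul] at h1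
      rw [hGGB] at h1
      rw [Subring.coe_mul, mul_comm]
      exact h1
    rw [this]
    exact hy'
  obtain ⟨s, hs𝔫, hsG⟩ := hGt'
  -- mod `x`: `mk s · mk G_B ∈ 𝔫̄²`, `mk s ∉ 𝔫̄`, `𝔫̄` prime
  let 𝔫bar : Ideal (blowupRing R ((t i₀ : R) : K) ⧸ I) := 𝔫.map mk
  have hI𝔫 : I ≤ 𝔫 := (Ideal.span_singleton_le_iff_mem _).mpr hx𝔫
  haveI : 𝔫bar.IsPrime := Ideal.map_isPrime_of_surjective Ideal.Quotient.mk_surjective (by rwa [Ideal.mk_ker])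
  have hcomap : 𝔫bar.comap mk = 𝔫 := by
    rw [Ideal.comap_map_of_surjective _ Ideal.Quotient.mk_surjective, ← RingHom.ker_eq_comap_bot, Ideal.mk_ker, sup_eq_left]
    exact hI𝔫
  have hmks : mk s ∉ 𝔫bar := fun hcon => hs𝔫 (by rw [← hcomap, Ideal.mem_comap]; exact hcon)
  have hmksG : mk s * mk GB ∈ 𝔫bar ^ 2 := by
    rw [← map_mul]
    have : (𝔫 ^ 2 ⊔ I).map mk = 𝔫bar ^ 2 := by
      rw [Ideal.map_sup, Ideal.map_pow]
      have : I.map mk = ⊥ := by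
        rw [Ideal.map_span, Set.image_singleton, Ideal.span_singleton_eq_bot]
        exact hmkx
      rw [this, sup_bot_eq]
    rw [← this]
    exact Ideal.mem_map_of_mem mk hsG
  -- through `e.symm`: `s' · q̄ ∈ P²`, `s' ∉ P`, `P` prime — contradiction with the Jacobian argument
  let P : Ideal (MvPolynomial {j : Fin d // j ≠ i₀} (ResidueField R)) := 𝔫bar.comap e.toRingHom
  haveI : P.IsPrime := Ideal.comap_isPrime _ _
  have hs'P : e.symm (mk s) ∉ P := by
    intro hcon
    rw [Ideal.mem_comap] at hcon
    exact hmks (by simpa using hcon)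
  have hqbar : e.symm (mk GB) = qbar := by
    rw [e.symm_apply_eq, he, hψG]
  have hsq : e.symm (mk s) * ∑ i, ∑ j, aC i j * Tt i * Tt j ∈ P ^ 2 := by
    rw [← hqdef, ← hqbar, ← map_mul]
    exact symm_mem_sq_comap e 𝔫bar hmksG
  exact hs'P (mem_of_mul_quad_mem_sq aC Tt i₀ hTt0 (fun k hk => pderiv ⟨k, hk⟩) hDa hDT β hβ P hsq)



/-- **THE MORSE EXIT, for the quadratic transform given as any subring** `R₁ = (R[𝔪/t_{i₀}])_{𝔪_O ∩ …}` (bookkeeping form of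
`not_coneVertex_of_nondegenerate`, e.g. for `R₁ = locAtCentre A'' O` a finitely generated model). [folklore] -/
theorem not_coneVertex_of_nondegenerate' {O : ValuationSubring K} {R : Subring K} [IsRegularLocalRing R]
    (hdom : SubringDominates R O.toSubring)
    {d : ℕ} (hd : (maximalIdeal R).spanFinrank = d) (t : Fin d → R) (ht : Ideal.span (Set.range t) = maximalIdeal R)
    (a : Fin d → Fin d → R) (h : R) (hQ : h - ∑ i, ∑ j, a i j * t i * t j ∈ maximalIdeal R ^ 3)
    (hJ : ∀ i, t i ∈ Ideal.span (Set.range fun k => ∑ j, (a k j + a j k) * t j) ⊔ maximalIdeal R ^ 2)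
    (i₀ : Fin d) (hmin : ∀ y ∈ maximalIdeal R, O.valuation (y : K) ≤ O.valuation (t i₀ : K))
    {R₁ : Subring K} (hR₁ : R₁ = locAtCentre (blowupRing R ((t i₀ : R) : K)) O) [IsLocalRing R₁]
    (hxR₁ : ((t i₀ : R) : K) ∈ R₁) (G : R₁) (hG : (h : K) = ((t i₀ : R) : K) ^ 2 * (G : K)) :
    G ∉ maximalIdeal R₁ ^ 2 ⊔ Ideal.span {(⟨((t i₀ : R) : K), hxR₁⟩ : R₁)} := by
  subst hR₁
  exact not_coneVertex_of_nondegenerate hdom hd t ht a h hQ hJ i₀ hmin G hG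

end Ring

/-! ## §4 Model level: `CleanLUConcl` through a nondegenerate quadratic END stage, for every valuation -/

/-- **MORSE EXIT ⟹ CLEAN.**  Let `A ⊆ A' ⊆ O` be finitely generated models of `K/k` with `R = locAtCentre A' O` regular of positive dimension, `t` a regular
system of parameters of `R`, and `h = Σ_{j<p} c_j^p g₀^j ∈ R` a non-trivial representative of the `K^p`-line of `g₀` with `h ≡ Σ a_ij t_i t_j (mod 𝔪³)`
whose polar forms `Σ_j (a_kj + a_jk) t_j` span `𝔪/𝔪²` (nondegenerate quadratic tangent cone).  If `p ≠ 2`, then `CleanLUConcl p k K O A g₀`: on the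
quadratic transform along `O` (again a finitely generated model) `h = x² G` with `x` the exceptional parameter and `G` a unit or a transversal regular
parameter (`not_coneVertex_of_nondegenerate` + ✓ `ConeExit.cleanLUConcl_of_unit_mul_pow(_mul)`).  EVERY valuation ring `O`, every ground field.
[folklore] -/
theorem cleanLUConcl_of_nondegenerate {p : ℕ} (hp : p.Prime) (hp2 : p ≠ 2) {k K : Type} [Field k] [Field K] [Algebra k K]
    (O : ValuationSubring K) (A A' : Subalgebra k K)
    (hA'O : A'.toSubring ≤ O.toSubring) (hAA' : A ≤ A') (hA'fg : A'.FG)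
    (hreg : IsRegularLocalRing (locAtCentre A'.toSubring O)) (g₀ : K)
    (c : Fin p → K) (hc0 : ∃ j : Fin p, (j : ℕ) ≠ 0 ∧ c j ≠ 0)
    (h : locAtCentre A'.toSubring O) (hc : ∑ j : Fin p, c j ^ p * g₀ ^ (j : ℕ) = (h : K))
    {d : ℕ} (hd0 : 0 < d) (hd : (maximalIdeal (locAtCentre A'.toSubring O)).spanFinrank = d)
    (t : Fin d → locAtCentre A'.toSubring O) (ht : Ideal.span (Set.range t) = maximalIdeal (locAtCentre A'.toSubring O))
    (a : Fin d → Fin d → locAtCentre A'.toSubring O)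
    (hQ : h - ∑ i, ∑ j, a i j * t i * t j ∈ maximalIdeal (locAtCentre A'.toSubring O) ^ 3)
    (hJ : ∀ i, t i ∈ Ideal.span (Set.range fun k => ∑ j, (a k j + a j k) * t j) ⊔ maximalIdeal (locAtCentre A'.toSubring O) ^ 2) :
    CleanLUConcl p k K O A g₀ := by
  classical
  haveI := hreg
  have hRO : locAtCentre A'.toSubring O ≤ O.toSubring := locAtCentre_le hA'O
  have hdom : SubringDominates (locAtCentre A'.toSubring O) O.toSubring := subringDominates_locAtCentre hA'O
  have htm : ∀ j, t j ∈ maximalIdeal (locAtCentre A'.toSubring O) := fun j => ht ▸ Ideal.subset_span ⟨j, rfl⟩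
  have ht0 : ∀ j, ((t j : locAtCentre A'.toSubring O) : K) ≠ 0 := fun j h0 => rsop_ne_zero hd t ht j (Subtype.ext h0)
  -- a parameter of minimal value
  obtain ⟨i₀, -, -, hmax⟩ := exists_max_valuation O Finset.univ (fun j => ((t j : locAtCentre A'.toSubring O) : K))
    ⟨⟨0, hd0⟩, Finset.mem_univ _, ht0 _⟩
  have hmin : ∀ y ∈ maximalIdeal (locAtCentre A'.toSubring O), O.valuation (y : K) ≤ O.valuation (t i₀ : K) := by
    intro y hy
    rw [← ht] at hy
    induction hy using Submodule.span_induction with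
    | mem y hy =>
      obtain ⟨j, rfl⟩ := hy
      exact hmax j (Finset.mem_univ j)
    | zero => simp
    | add y z _ _ hy hz =>
      rw [Subring.coe_add]
      exact (Valuation.map_add _ _ _).trans (max_le hy hz)
    | smul r y _ hy =>
      rw [smul_eq_mul, Subring.coe_mul, map_mul]
      calc O.valuation (r : K) * O.valuation (y : K) ≤ 1 * O.valuation (t i₀ : K) :=
            mul_le_mul' ((O.valuation_le_one_iff _).mpr (hRO r.2)) hy
        _ = O.valuation (t i₀ : K) := one_mul _
  have hx : t i₀ ∈ maximalIdeal (locAtCentre A'.toSubring O) := htm i₀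
  have hx0 : t i₀ ≠ 0 := rsop_ne_zero hd t ht i₀
  have hx0K : ((t i₀ : locAtCentre A'.toSubring O) : K) ≠ 0 := ht0 i₀
  -- the quadratic transform in the `t i₀`-chart, as a finitely generated model
  have hq' := isQuadraticTransformAlong_chart hRO (t i₀) hx hx0 hmin
  obtain ⟨A'', hA''O, hAA'', -, hA''fg, hR₁A''⟩ :=
    exists_model_of_isLocalBlowup_with_input_le (A := A) hAA' hA'fg hq'.isLocalBlowup
  have hT : blowupRing (locAtCentre A'.toSubring O) ((t i₀ : locAtCentre A'.toSubring O) : K) ≤ locAtCentre A''.toSubring O :=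
    hR₁A'' ▸ le_locAtCentre _ O
  rw [hR₁A''] at hq'
  have hreg₁ : IsRegularLocalRing (locAtCentre A''.toSubring O) := hq'.isRegularLocalRing_of_isRegularLocalRing hreg
  haveI := hreg₁
  obtain ⟨hxR₁, hxm₁, hx2₁⟩ := chart_notMem_sq_transform hq' hdom (t i₀) hx hx0 hmin
  -- `h ∈ 𝔪²`, so `h = x² G`
  have hh2 : h ∈ maximalIdeal (locAtCentre A'.toSubring O) ^ 2 := by
    have hQ2 : ∑ i, ∑ j, a i j * t i * t j ∈ maximalIdeal (locAtCentre A'.toSubring O) ^ 2 := by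
      refine Ideal.sum_mem _ fun i _ => Ideal.sum_mem _ fun j _ => ?_
      rw [mul_assoc, pow_two]
      exact Ideal.mul_mem_left _ _ (Ideal.mul_mem_mul (htm i) (htm j))
    have h3 : h - ∑ i, ∑ j, a i j * t i * t j ∈ maximalIdeal (locAtCentre A'.toSubring O) ^ 2 :=
      Ideal.pow_le_pow_right (by norm_num) hQ
    have := Ideal.add_mem _ h3 hQ2
    rwa [sub_add_cancel] at this
  obtain ⟨G, hG⟩ := exists_eq_pow_mul_of_mem_pow (R₁ := locAtCentre A''.toSubring O) hx0K hT hh2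
  have hGt := not_coneVertex_of_nondegenerate' hdom hd t ht a h hQ hJ i₀ hmin hR₁A''.symm hxR₁ G hG
  have hp2' : ¬ p ∣ 2 := fun hd2 => hp2 ((Nat.prime_dvd_prime_iff_eq hp Nat.prime_two).mp hd2)
  by_cases hGu : IsUnit G
  · refine cleanLUConcl_of_unit_mul_pow O A A'' hA''O hAA'' hA''fg hreg₁ g₀ ⟨_, hxR₁⟩ hxm₁ hx2₁ G hGu 2 hp2' c hc0 ?_
    rw [hc, hG, mul_comm]
  · have hGm : G ∈ maximalIdeal (locAtCentre A''.toSubring O) := (mem_maximalIdeal _).mpr hGu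
    refine cleanLUConcl_of_unit_mul_pow_mul hp O A A'' hA''O hAA'' hA''fg hreg₁ g₀ ⟨_, hxR₁⟩ hxm₁ hx2₁ G hGm hGt
      1 isUnit_one 2 hp2' c hc0 ?_
    rw [hc, hG]
    simp

end Summit.ResolutionOfSingularities.ResolutionOfSingularities.Theorems.RadicialJung.CleanModels.ConeExit

end
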